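import Literature.MathematicalPhysics.QuantumFieldTheory.Balaban1983to89.B5Eq129FreeResolventSupBound
import Literature.MathematicalPhysics.QuantumFieldTheory.Balaban1983to89.B9Eq315FlatDictionary

/-!
# `Balaban1983to89.B5Eq129FreeResolventSupBoundSites` — T. Bałaban, *Propagators and renormalization transformations for lattice gauge theories. I*,
# Commun. Math. Phys. **95** (1984) 17–40 [Balaban1984PropagatorsI] (1.29)∕(1.31) p. 23, Prop. 1.1 p. 33, read on the pub-balaban NE9 chain's SITE CARRIER
# `TSite d P = Π_i Fin (P i)` of [Balaban1985BackgroundPropagators] (3.1) p. 390 through the site dictionary `TSite d P ≃ Tor P` (`B9Eq315FlatDictionary`):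
# **THE FLAT SCALAR LETTER (FS) OF THE SUP-NORM BOOTSTRAP ON THE CHAIN's LATTICE — any letter proved on b05's torus `Tor P` with `± unitVec` transports to
# `TSite d P` with `shift`∕`unshift`, and the spectral (FS-a) of `B5Eq129FreeResolventSupBound` so transported, in both the `Σ_ν` and the `Σ_{Fin d ⊕ Fin d}`
# (`Sum.elim unshift shift`) shapes that `B9Eq323KatoDomination` §3 ∕ `B9Eq342SupNormBootstrap.norm_le_of_kato_bootstrap` consume** — stone (FS-t) of plan v10

statement-level skeleton of published theorems with citation tags; proofs where landed; nothing here is a claim about the Yang–Mills mass gap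

CITATION HEADER (lean-in-tree rule).  Audit cell `pub-balaban`, sub-cell `t4`, BINDER row NE9; filed by the row OWNER lineage `b2b-balaban-t4-ne9-p1` (gen 89,
plan v10 `g89/SUP-NORM-PROGRAMME.md` §3 (vi) «TRANSPORT»).  Sources as quoted verbatim in `B5Eq129FreeResolventSupBound` ([Balaban1984PropagatorsI] (1.29), (1.31),
Prop. 1.1) and `B9Eq315FlatDictionary` ([Balaban1985BackgroundPropagators] (3.1)∕(3.3)∕(3.8): the periodic lattice and its unit steps); the dictionary
`torCast_bijective`, `torCast_shift` («`shift κ x` is `(x mod P) + unitVec κ`»), `torCast_unshift` is ne9-leaf-03 g58's, USED BY NAME.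

WHY THIS FILE (cell context).  The bootstrap `B9Eq342SupNormBootstrap.norm_le_of_kato_bootstrap` is abstract over the site type `ι`; for the chain's covariant
Laplacian (3.23) `covLaplaceSiteK` (`B9Eq323KatoDomination` §3) the site type is FORCED to be `TSite d P` with neighbours `Sum.elim (unshift · x) (shift · x)`,
while the Fourier letter (FS-a) (`B5Eq129FreeResolventSupBound.le_of_double_resolvent_weighted`) and its level-free zone-sum bound (FS-b) live on b05's
`Tor P = Π ZMod (P i)` (King's `ft`, `B5Prop11Plancherel`'s characters).  This file is the one-time transport, so that every (FS)-type letter proved on `Tor P`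
— with ANY constant — is available in the exact `hFS` shape of the bootstrap on the chain's carrier.

WHAT IS PROVED (sorry-free; 0 `def`; [folklore] reindexing along a bijection).
* §1 **`fs_tsite_of_tor`** — TRANSPORT: if on `Tor P` every solution pair `(L₀+m)φ₁ = ψ ≥ 0`, `(L₀+m)φ₂ = φ₁` (flat Laplacian `Σ_ν t²[(φ(x) − φ(x − e_ν)) + (φ(x) −
  φ(x + e_ν))]`) satisfies `φ₂(x) ≤ C·√(Σ_y c₀ψ(y)²)`, then the same holds on `TSite d P` with `unshift`∕`shift` — same `C`; **`fs_tsite_of_tor_sumElim`** — the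
  conclusion in the `Σ_{j : Fin d ⊕ Fin d} t²·(φ x − φ (Sum.elim (unshift · x) (shift · x) j))` shape of `norm_le_of_kato_bootstrap`'s `hFS`.
* §2 **`le_of_double_resolvent_weighted_tsite`** ∕ **`…_sumElim`** — (FS-a) ON THE CHAIN's LATTICE: `φ₂(x) ≤ √((c₀|T|)⁻¹Σ_{p∈Tor P}(Δ_t(p)+m)⁻⁴)·√(Σ_y c₀ψ(y)²)`,
  `Δ_t(p) = Σ_ν t²(2 − 2Re χ_p(e_ν))`, for every torus, every real `t`, every `0 < m`, `0 < c₀`.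
HONEST SCOPE.  Bookkeeping; the constant stays SPECTRAL (its level-free bound (FS-b) is a separate stone); free scalar Laplacian only.  NOT summit progress (cell
pub-balaban: NE9 NOT PRINTED ∕ NOT PROVED; «NE9 ⇐ the named binders»; row WALLED ON A MODEL (O-NE9-1; #5 UNRULED); spine PROVED 0∕9; rung (B)+1 finite T⁴ — NOT
infinite volume, NOT mass gap, NOT BetaPertH, NOT Clay).  HONEST DEPENDENCY (cell line): continuum YM on T⁴ ⇐ BetaPertH ∧ nine spine estimates (0/9 proved);
BetaPertH ⇐ (D1) ∧ (D4) ∧ CAP+tail; G-an2-4 gates asym, D1 and NE2/3/4.  NEW file importing `B5Eq129FreeResolventSupBound` + `B9Eq315FlatDictionary`; nothing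
modified.  Net new unproved facts: 0.
-/

noncomputable section

open scoped BigOperators

namespace Literature.MathematicalPhysics.QuantumFieldTheory.Balaban1983to89.B5Eq129FreeResolventSupBoundSites

open B4Sect5Torus (TSite)
open B9SectCLatticeCarrier (shift unshift)
open B5Prop11Plancherel (Tor chi unitVec)
open B9Eq315FlatDictionary (torCast_bijective torCast_shift torCast_unshift)
open B5Eq129FreeResolventSupBound (le_of_double_resolvent_weighted symbol_nonneg)

variable {d : ℕ}

/-- Re-bracketing: the `Σ_ν [· + ·]` form of the flat stencil IS the `Σ_{j : Fin d ⊕ Fin d}` form over `Sum.elim (unshift · x) (shift · x)` used by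
`B9Eq342SupNormBootstrap.norm_le_of_kato_bootstrap`. [folklore] [cite: Balaban1985BackgroundPropagators, (3.23) p.394] -/
theorem sum_sumElim_eq {P : Fin d → ℕ} (t : ℝ) (φ : TSite d P → ℝ) (x : TSite d P) :
    ∑ j : Fin d ⊕ Fin d, t ^ 2 * (φ x - φ (Sum.elim (fun μ => unshift μ x) (fun μ => shift μ x) j)) =
      ∑ ν, t ^ 2 * ((φ x - φ (unshift ν x)) + (φ x - φ (shift ν x))) := by
  rw [Fintype.sum_sum_type, ← Finset.sum_add_distrib]
  exact Finset.sum_congr rfl fun ν _ => by simp only [Sum.elim_inl, Sum.elim_inr]; ring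

variable (P : Fin d → ℕ) [∀ i, NeZero (P i)]

/-! ## §1 Transport of an (FS) letter from `Tor P` (`± unitVec`) to `TSite d P` (`shift`∕`unshift`) -/

/-- **TRANSPORT OF THE FLAT SCALAR LETTER ALONG THE SITE DICTIONARY**: an (FS) letter with constant `C` for the flat Laplacian on b05's torus `Tor P` (steps
`x ± e_ν`) yields the same letter, same constant, on the chain's periodic lattice `TSite d P` (steps `shift ν x`, `unshift ν x`).
[cite: Balaban1985BackgroundPropagators, (3.1) p.390, (3.3) p.391; Balaban1984PropagatorsI, (1.29) p.23] -/
theorem fs_tsite_of_tor {t m C c₀ : ℝ}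
    (H : ∀ ψ φ₁ φ₂ : Tor P → ℝ, (∀ x, 0 ≤ ψ x) →
      (∀ x, ∑ ν, t ^ 2 * ((φ₁ x - φ₁ (x - unitVec P ν)) + (φ₁ x - φ₁ (x + unitVec P ν))) + m * φ₁ x = ψ x) →
      (∀ x, ∑ ν, t ^ 2 * ((φ₂ x - φ₂ (x - unitVec P ν)) + (φ₂ x - φ₂ (x + unitVec P ν))) + m * φ₂ x = φ₁ x) →
      ∀ x, φ₂ x ≤ C * Real.sqrt (∑ y, c₀ * ψ y ^ 2))
    {ψ φ₁ φ₂ : TSite d P → ℝ} (hψ : ∀ x, 0 ≤ ψ x)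
    (h₁ : ∀ x, ∑ ν, t ^ 2 * ((φ₁ x - φ₁ (unshift ν x)) + (φ₁ x - φ₁ (shift ν x))) + m * φ₁ x = ψ x)
    (h₂ : ∀ x, ∑ ν, t ^ 2 * ((φ₂ x - φ₂ (unshift ν x)) + (φ₂ x - φ₂ (shift ν x))) + m * φ₂ x = φ₁ x) (x : TSite d P) :
    φ₂ x ≤ C * Real.sqrt (∑ y, c₀ * ψ y ^ 2) := by
  set e : TSite d P ≃ Tor P := Equiv.ofBijective _ (torCast_bijective P) with he
  have hsh : ∀ ν (y : TSite d P), e (shift ν y) = e y + unitVec P ν := fun ν y => torCast_shift P ν y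
  have hush : ∀ ν (y : TSite d P), e (unshift ν y) = e y - unitVec P ν := fun ν y => torCast_unshift P ν y
  have hsh' : ∀ ν (z : Tor P), e.symm (z + unitVec P ν) = shift ν (e.symm z) := fun ν z =>
    e.injective (by rw [Equiv.apply_symm_apply, hsh, Equiv.apply_symm_apply])
  have hush' : ∀ ν (z : Tor P), e.symm (z - unitVec P ν) = unshift ν (e.symm z) := fun ν z =>
    e.injective (by rw [Equiv.apply_symm_apply, hush, Equiv.apply_symm_apply])
  have H' := H (fun z => ψ (e.symm z)) (fun z => φ₁ (e.symm z)) (fun z => φ₂ (e.symm z)) (fun z => hψ _)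
    (fun z => by simp only [hsh', hush']; exact h₁ _) (fun z => by simp only [hsh', hush']; exact h₂ _) (e x)
  simp only [Equiv.symm_apply_apply] at H'
  have hsum : ∑ y : Tor P, c₀ * ψ (e.symm y) ^ 2 = ∑ y : TSite d P, c₀ * ψ y ^ 2 := Equiv.sum_comp e.symm (fun y => c₀ * ψ y ^ 2)
  rwa [hsum] at H'

/-- **TRANSPORT, `Sum.elim` SHAPE**: the same letter with the equations written over `j : Fin d ⊕ Fin d`, `nbr x j = Sum.elim (unshift · x) (shift · x) j`,
weights `t²` — LITERALLY the binder `hFS` of `B9Eq342SupNormBootstrap.norm_le_of_kato_bootstrap` at `ι = TSite d P`, `c = fun _ => c₀`.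
[cite: Balaban1985BackgroundPropagators, (3.1) p.390, (3.23) p.394] -/
theorem fs_tsite_of_tor_sumElim {t m C c₀ : ℝ}
    (H : ∀ ψ φ₁ φ₂ : Tor P → ℝ, (∀ x, 0 ≤ ψ x) →
      (∀ x, ∑ ν, t ^ 2 * ((φ₁ x - φ₁ (x - unitVec P ν)) + (φ₁ x - φ₁ (x + unitVec P ν))) + m * φ₁ x = ψ x) →
      (∀ x, ∑ ν, t ^ 2 * ((φ₂ x - φ₂ (x - unitVec P ν)) + (φ₂ x - φ₂ (x + unitVec P ν))) + m * φ₂ x = φ₁ x) →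
      ∀ x, φ₂ x ≤ C * Real.sqrt (∑ y, c₀ * ψ y ^ 2)) :
    ∀ ψ φ₁ φ₂ : TSite d P → ℝ, (∀ x, 0 ≤ ψ x) →
      (∀ x, ∑ j : Fin d ⊕ Fin d, t ^ 2 * (φ₁ x - φ₁ (Sum.elim (fun μ => unshift μ x) (fun μ => shift μ x) j)) + m * φ₁ x = ψ x) →
      (∀ x, ∑ j : Fin d ⊕ Fin d, t ^ 2 * (φ₂ x - φ₂ (Sum.elim (fun μ => unshift μ x) (fun μ => shift μ x) j)) + m * φ₂ x = φ₁ x) →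
      ∀ x, φ₂ x ≤ C * Real.sqrt (∑ y, (fun _ : TSite d P => c₀) y * ψ y ^ 2) := by
  intro ψ φ₁ φ₂ hψ h₁ h₂ x
  exact fs_tsite_of_tor P H (ψ := ψ) (φ₁ := φ₁) (φ₂ := φ₂) hψ (fun y => by rw [← sum_sumElim_eq]; exact h₁ y)
    (fun y => by rw [← sum_sumElim_eq]; exact h₂ y) x

/-! ## §2 The spectral letter (FS-a) on the chain's lattice -/

/-- **(FS-a) ON `TSite d P`**: for the flat Laplacian with weight `t²`, `0 < m`, `0 < c₀`, and real lattice functions with `(L₀+m)φ₁ = ψ`, `(L₀+m)φ₂ = φ₁`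
(steps `shift`∕`unshift`): `φ₂(x) ≤ √((c₀|T|)⁻¹·Σ_{p ∈ Tor P}(Δ_t(p)+m)⁻⁴)·√(Σ_y c₀ψ(y)²)`, `Δ_t(p) = Σ_ν t²(2 − 2Re χ_p(e_ν))`.
[cite: Balaban1984PropagatorsI, (1.29) p.23, Prop. 1.1 p.33; Balaban1985BackgroundPropagators, (3.11) p.392] -/
theorem le_of_double_resolvent_weighted_tsite (t : ℝ) {m c₀ : ℝ} (hm : 0 < m) (hc₀ : 0 < c₀) {ψ φ₁ φ₂ : TSite d P → ℝ}
    (h₁ : ∀ x, ∑ ν, t ^ 2 * ((φ₁ x - φ₁ (unshift ν x)) + (φ₁ x - φ₁ (shift ν x))) + m * φ₁ x = ψ x)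
    (h₂ : ∀ x, ∑ ν, t ^ 2 * ((φ₂ x - φ₂ (unshift ν x)) + (φ₂ x - φ₂ (shift ν x))) + m * φ₂ x = φ₁ x) (x : TSite d P) :
    φ₂ x ≤ Real.sqrt ((∑ p : Tor P, ((∑ ν, t ^ 2 * (2 - 2 * (chi P p (unitVec P ν)).re) + m) ^ 4)⁻¹) / (c₀ * Fintype.card (Tor P))) *
      Real.sqrt (∑ y, c₀ * ψ y ^ 2) := by
  -- the letter on `Tor P` holds for every `ψ` (no sign condition is used there); transport it with the trivial sign hypothesis on `|ψ|`-free data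
  have H : ∀ ψ' φ₁' φ₂' : Tor P → ℝ, (∀ z, 0 ≤ ψ' z ∨ True) →
      (∀ z, ∑ ν, t ^ 2 * ((φ₁' z - φ₁' (z - unitVec P ν)) + (φ₁' z - φ₁' (z + unitVec P ν))) + m * φ₁' z = ψ' z) →
      (∀ z, ∑ ν, t ^ 2 * ((φ₂' z - φ₂' (z - unitVec P ν)) + (φ₂' z - φ₂' (z + unitVec P ν))) + m * φ₂' z = φ₁' z) →
      ∀ z, φ₂' z ≤ Real.sqrt ((∑ p : Tor P, ((∑ ν, t ^ 2 * (2 - 2 * (chi P p (unitVec P ν)).re) + m) ^ 4)⁻¹) / (c₀ * Fintype.card (Tor P))) *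
        Real.sqrt (∑ y, c₀ * ψ' y ^ 2) :=
    fun ψ' φ₁' φ₂' _ h₁' h₂' z => le_of_double_resolvent_weighted P t hm hc₀ h₁' h₂' z
  -- repeat the transport argument of §1 without the sign hypothesis
  set e : TSite d P ≃ Tor P := Equiv.ofBijective _ (torCast_bijective P) with he
  have hsh : ∀ ν (y : TSite d P), e (shift ν y) = e y + unitVec P ν := fun ν y => torCast_shift P ν y
  have hush : ∀ ν (y : TSite d P), e (unshift ν y) = e y - unitVec P ν := fun ν y => torCast_unshift P ν y
  have hsh' : ∀ ν (z : Tor P), e.symm (z + unitVec P ν) = shift ν (e.symm z) := fun ν z =>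
    e.injective (by rw [Equiv.apply_symm_apply, hsh, Equiv.apply_symm_apply])
  have hush' : ∀ ν (z : Tor P), e.symm (z - unitVec P ν) = unshift ν (e.symm z) := fun ν z =>
    e.injective (by rw [Equiv.apply_symm_apply, hush, Equiv.apply_symm_apply])
  have H' := H (fun z => ψ (e.symm z)) (fun z => φ₁ (e.symm z)) (fun z => φ₂ (e.symm z)) (fun z => Or.inr trivial)
    (fun z => by simp only [hsh', hush']; exact h₁ _) (fun z => by simp only [hsh', hush']; exact h₂ _) (e x)
  simp only [Equiv.symm_apply_apply] at H'
  have hsum : ∑ y : Tor P, c₀ * ψ (e.symm y) ^ 2 = ∑ y : TSite d P, c₀ * ψ y ^ 2 := Equiv.sum_comp e.symm (fun y => c₀ * ψ y ^ 2)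
  rwa [hsum] at H'

/-- **(FS-a) ON `TSite d P`, `Sum.elim` SHAPE** — the binder `hFS` of `norm_le_of_kato_bootstrap` at `ι = TSite d P`, `J = Fin d ⊕ Fin d`, weights `t²`,
`c = fun _ => c₀`, with the SPECTRAL constant `C₃ = √((c₀|T|)⁻¹Σ_p(Δ_t(p)+m)⁻⁴)`. [cite: Balaban1984PropagatorsI, (1.29) p.23, Prop. 1.1 p.33] -/
theorem le_of_double_resolvent_weighted_tsite_sumElim (t : ℝ) {m c₀ : ℝ} (hm : 0 < m) (hc₀ : 0 < c₀) :
    ∀ ψ φ₁ φ₂ : TSite d P → ℝ, (∀ x, 0 ≤ ψ x) →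
      (∀ x, ∑ j : Fin d ⊕ Fin d, t ^ 2 * (φ₁ x - φ₁ (Sum.elim (fun μ => unshift μ x) (fun μ => shift μ x) j)) + m * φ₁ x = ψ x) →
      (∀ x, ∑ j : Fin d ⊕ Fin d, t ^ 2 * (φ₂ x - φ₂ (Sum.elim (fun μ => unshift μ x) (fun μ => shift μ x) j)) + m * φ₂ x = φ₁ x) →
      ∀ x, φ₂ x ≤ Real.sqrt ((∑ p : Tor P, ((∑ ν, t ^ 2 * (2 - 2 * (chi P p (unitVec P ν)).re) + m) ^ 4)⁻¹) / (c₀ * Fintype.card (Tor P))) *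
        Real.sqrt (∑ y, (fun _ : TSite d P => c₀) y * ψ y ^ 2) := by
  intro ψ φ₁ φ₂ _ h₁ h₂ x
  exact le_of_double_resolvent_weighted_tsite P t hm hc₀ (ψ := ψ) (φ₁ := φ₁) (φ₂ := φ₂) (fun y => by rw [← sum_sumElim_eq]; exact h₁ y)
    (fun y => by rw [← sum_sumElim_eq]; exact h₂ y) x

end Literature.MathematicalPhysics.QuantumFieldTheory.Balaban1983to89.B5Eq129FreeResolventSupBoundSites

end
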